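import Summits.BirchSwinnertonDyer.BirchSwinnertonDyer.Theorems.KolyvaginDepthDoorKolyvaginDepthSupplyDoorOfDatumPrint
import Summits.BirchSwinnertonDyer.BirchSwinnertonDyer.Theorems.KolyvaginDepthDoorKolyvaginDepthSupplyDoorNoTwistTwistSelmer
import HarnessLib

/-!
# Route `KolyvaginDepthDoor`, crux `KolyvaginDepthSupply` (stmt-BirchSwinnertonDyer-21765) —
# THE TWIST-SELMER DOOR OF A DATUM ON PRINT-STANDARD INPUTS: `#Sel_p(E^{(d_K)}/ℚ) ≤ p^ν` from the bit at
# ANY datum, (γ) [Gross 3.7 (2)] and {the Kodaira–Néron side condition | F1 [GZ86 III (3.1)]}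

Helper file (`--supports stmt-BirchSwinnertonDyer-21765 --as helper`); it closes nothing and BSD is
not proved by it.

g6/g7's twist-Selmer door (`natCard_selmerGroup_twist_le_of_hypothesesDepth`, `…_of_datum`) reads
Kolyvagin's SECOND eigen-bound `#Sel_p(E/K)^- ≤ p^ν` over `ℚ`: `#Sel_p(E^{(d_K)}/ℚ) ≤ p^ν` and
`p^{rank E^{(d_K)}} · #E^{(d_K)}(ℚ)[p] · #Ш(E^{(d_K)}/ℚ)[p] ≤ p^ν`, modulo the five McCallum leaves.
This file re-issues it on print-standard inputs (as `…DoorOfDatumPrint` did for the `+`-side):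

* `exists_hypothesesDepth_of_datum_of_hfin` — the `∃ S : HypothesesDepth` form of the print door
  (`S.c n₁ = c_1(n₁)` of the given datum), `hfin` displayed;
* `natCard_selmerGroup_twist_le_of_kolyvaginClass_ne_zero_of_datum_kodairaNeron` — twist-Selmer door
  on (γ) + (KN_p); `…_gross1991E0` — on (γ) + F1.

CONDITIONAL on (γ) [+ F1]; per-curve; BSD is not proved by it.

References: [Kolyvagin1991MathAnn] Thm. 2.3; [GrossLMS1991] Prop. 3.7 (2), §5 (5.1), §10;
[McCallumLMS1991] §§2–5; [GrossZagier1986] III (3.1).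
-/

set_option linter.dupNamespace false

noncomputable section

open scoped Classical

namespace Summit.BirchSwinnertonDyer.BirchSwinnertonDyer.Theorems.KolyvaginDepthDoor

open Literature.NumberTheory.EllipticCurves Literature.NumberTheory.EllipticCurves.ModularForms
  Literature.NumberTheory.EllipticCurves.KolyvaginDescent
  Literature.NumberTheory.EllipticCurves.McCallum1991 WeierstrassCurve NumberField IsDedekindDomain
open Literature.NumberTheory.DiophantineGeometry (KodairaSymbol)

section Datum

variable {W : WeierstrassCurve ℚ} [W.IsElliptic] [W.IsGloballyMinimal] [NeZero (W.conductorNorm ℤ)]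
  {K : Type} [Field K] [NumberField K]
  {Dt : ModularParametrizationData W (W.conductorNorm ℤ)} {β : ℤ} {ι : K →+* ℂ}

/-- **Kolyvagin's minimal-depth descent data THROUGH A DATUM, with the local-triviality clause `hfin`
as its only remaining local input** (the `∃ S` form of `…_of_hfin` in `…DoorOfDatumPrint`: `h54`,
`h53`, `h22` and the archimedean half of `h43` DISCHARGED, `h44` from (γ), the finite half of `h43`
displayed as `hfin`); `S.c n₁` IS the class `c_1(n₁)` of the given datum (the compatible system through
`d₁`, `exists_kolyvaginHeegnerSystem_extending`). [cite: Kolyvagin1991MathAnn, Thm. 2.3]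
[cite: McCallumLMS1991, §§2–5] [cite: GrossLMS1991, Prop. 3.7 (2), §10] -/
theorem exists_hypothesesDepth_of_datum_of_hfin
    (h372 : GrossLMS1991.prop37_2_frobeniusCongruence)
    (hcm : ¬ W.HasCM) (hK : IsImaginaryQuadratic K) (hD3 : NumberField.discr K ≠ -3)
    (hD4 : NumberField.discr K ≠ -4) (hH : SatisfiesHeegnerHypothesis (W.conductorNorm ℤ) K)
    (p : ℕ) [hp : Fact p.Prime] (hp2 : p ≠ 2)
    (htower : ∀ n : ℕ, W.HasSurjectiveModNGaloisRep (p ^ n : ℕ))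
    (c : K ≃ₐ[ℚ] K) (hc : c ≠ 1) (hcc : c * c = 1)
    (hfin : ∀ (n : ℕ), Squarefree n →
      (∀ q ∈ n.primeFactors, Zhang2014.IsKolyvaginPrime (W.conductorNorm ℤ) W K p q) →
      ∀ (d : KolyvaginHeegnerData Dt β ι n) (v : HeightOneSpectrum (𝓞 K)), (n : 𝓞 K) ∉ v.asIdeal →
        d.kolyvaginClass hp.out 1 ∈ selmerLocalKer (W.baseChange K) (v.adicCompletion K) ((p ^ 1 : ℕ) : ℤ))
    {n₁ : ℕ} (hn₁ : Squarefree n₁)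
    (hk₁ : ∀ q ∈ n₁.primeFactors, Zhang2014.IsKolyvaginPrime (W.conductorNorm ℤ) W K p q)
    (d₁ : KolyvaginHeegnerData Dt β ι n₁) :
    ∃ S : HypothesesDepth (galH1Torsion (W.baseChange K) ((p ^ 1 : ℕ) : ℤ))
        (HeightOneSpectrum (𝓞 K) ⊕ InfinitePlace K),
      S.Sel = selmerGroup (W.baseChange K) ((p ^ 1 : ℕ) : ℤ) ∧ S.p = p ∧
        S.c n₁ = d₁.kolyvaginClass hp.out 1 ∧
        S.Kol = Zhang2014.IsKolyvaginPrime (W.conductorNorm ℤ) W K p ∧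
        S.τ = conjAct W c ((p ^ 1 : ℕ) : ℤ) := by
  have hρ : W.HasSurjectiveModNGaloisRep p := by simpa only [pow_one] using htower 1
  have h44 : prop44_localOrder_kolyvaginClass_mul_eq :=
    Summit.BirchSwinnertonDyer.Rank1Residual.JET.prop44_of_frobeniusCongruence h372
  -- `ℓ' ∈ S₁(1)` for every Kolyvagin prime (Zhang's `0 < M(ℓ')`), and Kolyvagin primes are inert
  have hS1 : ∀ {n : ℕ}, (∀ q ∈ n.primeFactors, Zhang2014.IsKolyvaginPrime (W.conductorNorm ℤ) W K p q) →
      ∀ q ∈ n.primeFactors, Zhang2014.IsKolyvaginPrime (W.conductorNorm ℤ) W K p q ∧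
        1 ≤ Zhang2014.kolyvaginIndex W p q :=
    fun h q hq ↦ ⟨h q hq, (h q hq).2.2.2.2.2⟩
  have hinert : ∀ {n : ℕ},
      (∀ q ∈ n.primeFactors, Zhang2014.IsKolyvaginPrime (W.conductorNorm ℤ) W K p q) →
      ∀ q ∈ n.primeFactors, (Ideal.span {(q : 𝓞 K)}).IsPrime :=
    fun h q hq ↦ (h q hq).2.2.2.2.1
  have hd4 : NumberField.discr K < -4 := discr_lt_neg_four_of_frame hK hD3 hD4 d₁.dvd_sq_sub
  -- the compatible system through `d₁`
  obtain ⟨d, hd₁, hcoh⟩ :=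
    exists_kolyvaginHeegnerSystem_extending hK hd4 hH Dt β ι hn₁ (hinert hk₁) d₁
  -- its class family (junk `0` off the good levels)
  let cl : ℕ → galH1Torsion (W.baseChange K) ((p ^ 1 : ℕ) : ℤ) := fun n ↦
    if h : Squarefree n ∧ ∀ q ∈ n.primeFactors, (Ideal.span {(q : 𝓞 K)}).IsPrime then
      (d n h.1 h.2).kolyvaginClass hp.out 1 else 0
  have hcl : ∀ (n : ℕ) (hn : Squarefree n)
      (hin : ∀ q ∈ n.primeFactors, (Ideal.span {(q : 𝓞 K)}).IsPrime),
      cl n = (d n hn hin).kolyvaginClass hp.out 1 := fun n hn hin ↦ by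
    simp only [cl, dif_pos (show Squarefree n ∧ _ from ⟨hn, hin⟩)]
  -- the sign law (Gross Prop. 5.4 (2)) — PROVED (`…LeafSign`)
  obtain ⟨ε, hε, hsign⟩ :=
    sign_conjAct_kolyvaginClass_holds W hcm K hK hD3 hD4 hH p hp2 htower c hc Dt β ι 1 le_rfl
  -- `h44`: McCallum Prop. 4.4 "in particular" for the compatible pairs `(d m, d (m l))`, from (γ)
  have hh44 : ∀ (l m : ℕ), Squarefree (l * m) →
      (∀ q ∈ (l * m).primeFactors, Zhang2014.IsKolyvaginPrime (W.conductorNorm ℤ) W K p q) →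
      Zhang2014.IsKolyvaginPrime (W.conductorNorm ℤ) W K p l →
      ∀ v : HeightOneSpectrum (𝓞 K), (l : 𝓞 K) ∈ v.asIdeal →
        (cl (l * m) ∈ selmerLocalKer (W.baseChange K) (v.adicCompletion K) ((p ^ 1 : ℕ) : ℤ) ↔
          cl m ∈ (W.baseChange K).torsionLocalKer (v.adicCompletion K) ((p ^ 1 : ℕ) : ℤ)) := by
    intro l m hsq hk hl v hv
    have hsq' : Squarefree (m * l) := by rwa [Nat.mul_comm] at hsq
    have hk' : ∀ q ∈ (m * l).primeFactors, Zhang2014.IsKolyvaginPrime (W.conductorNorm ℤ) W K p q ∧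
        1 ≤ Zhang2014.kolyvaginIndex W p q := by
      rw [Nat.mul_comm]
      exact hS1 hk
    have hkml : ∀ q ∈ (m * l).primeFactors, Zhang2014.IsKolyvaginPrime (W.conductorNorm ℤ) W K p q :=
      fun q hq ↦ (hk' q hq).1
    have hm : Squarefree m := hsq'.squarefree_of_dvd (dvd_mul_right m l)
    have hkm : ∀ q ∈ m.primeFactors, Zhang2014.IsKolyvaginPrime (W.conductorNorm ℤ) W K p q :=
      fun q hq ↦ hkml q (Nat.mem_primeFactors.mpr ⟨Nat.prime_of_mem_primeFactors hq,
        (Nat.dvd_of_mem_primeFactors hq).trans (dvd_mul_right m l), hsq'.ne_zero⟩)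
    have hlm : ¬ l ∣ m := by
      intro hdiv
      have hll : l * l ∣ l * m := Nat.mul_dvd_mul_left l hdiv
      exact hl.1.not_isUnit (hsq l hll)
    obtain ⟨hσ, hS₁, hS₂, hemb⟩ :=
      hcoh m (m * l) hm (hinert hkm) hsq' (hinert hkml) (dvd_mul_right m l)
    have hA := kolyvaginClass_mul_mem_selmerLocalKer_iff_of_prop44 h44 W hcm K hK hD3 hD4 hH p hp2
      htower Dt β ι 1 le_rfl m l hsq' hl.1 hlm hk' (d m hm (hinert hkm)) (d (m * l) hsq' (hinert hkml))
      hσ hS₁ hS₂ hemb v hv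
    have hB := kolyvaginClass_mul_mem_torsionLocalKer_iff_of_prop44 h44 W hcm K hK hD3 hD4 hH p hp2
      htower Dt β ι 1 le_rfl m l hsq' hl.1 hlm hk' (d m hm (hinert hkm)) (d (m * l) hsq' (hinert hkml))
      hσ hS₁ hS₂ hemb v hv
    rw [Nat.mul_comm l m, hcl (m * l) hsq' (hinert hkml), hcl m hm (hinert hkm)]
    exact hA.trans hB
  obtain ⟨S, hSel, hSp, hSc, hSK, hSτ⟩ := exists_hypothesesDepth_of_classes hcm hK p hp2 htower c hc
    hcc cl ε hε
    (fun n hn hk ↦ by rw [hcl n hn (hinert hk)]; exact hsign n hn (hS1 hk) _)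
    (fun n hn hk v hv ↦ by
      rw [hcl n hn (hinert hk)]
      exact hfin n hn hk _ v hv)
    (fun n hn hk w ↦ by
      rw [hcl n hn (hinert hk)]
      exact kolyvaginClass_mem_selmerLocalKer_infinitePlace hK _ hp.out 1 w)
    hh44
    (fun l hl e he s₁ hs₁ hτ₁ s₂ hs₂ hτ₂ ↦
      lemma53_selmer_eigen_dependent_at_one W Dt hK p hp2 htower c hc l hl e he s₁ hs₁ hτ₁ s₂ hs₂ hτ₂)
    (fun T hT l hlT e he x hx hoff hinf s hs hτs hsT v hv hsv ↦
      prop22_reciprocity_eigen_finset_one W Dt hK hp2 hρ hc T hT hlT he x hx hoff hinf s hs hτs hsT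
        v hv hsv)
  exact ⟨S, hSel, hSp, by rw [hSc, hcl n₁ hn₁ (hinert hk₁), hd₁], hSK, hSτ⟩


/-- **THE TWIST-SELMER DOOR OF A DATUM ON THE KODAIRA–NÉRON CELL**: with the hypotheses of
`shaCorank_eq_zero_of_kolyvaginClass_ne_zero_of_rank_le_of_datum_kodairaNeron` ((γ), (KN_p), ONE datum
`d₁` of conductor `n₁` with `c_1(n₁) ≠ 0`, `ν + 1 ≤ rank E(ℚ)`): `Sel_p(E^{(d_K)}/ℚ)` is finite,
`#Sel_p(E^{(d_K)}/ℚ) ≤ p^ν` and `p^{rank E^{(d_K)}(ℚ)} · #E^{(d_K)}(ℚ)[p] · #Ш(E^{(d_K)}/ℚ)[p] ≤ p^ν`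
(g6's `natCard_selmerGroup_twist_le_of_hypothesesDepth` on the descent data of
`exists_hypothesesDepth_of_datum_of_hfin`). CONDITIONAL on (γ); per-curve; BSD is not proved by it.
[cite: Kolyvagin1991MathAnn, Thm. 2.3] [cite: GrossLMS1991, §5 (5.1)] -/
theorem natCard_selmerGroup_twist_le_of_kolyvaginClass_ne_zero_of_datum_kodairaNeron
    (h372 : GrossLMS1991.prop37_2_frobeniusCongruence)
    (hcm : ¬ W.HasCM) (hK : IsImaginaryQuadratic K) (hD3 : NumberField.discr K ≠ -3)
    (hD4 : NumberField.discr K ≠ -4) (hH : SatisfiesHeegnerHypothesis (W.conductorNorm ℤ) K)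
    (p : ℕ) [hp : Fact p.Prime] (hp2 : p ≠ 2)
    (htower : ∀ n : ℕ, W.HasSurjectiveModNGaloisRep (p ^ n : ℕ))
    (c : K ≃ₐ[ℚ] K) (hc : c ≠ 1) (hcc : c * c = 1)
    (hmult : ∀ v : HeightOneSpectrum (𝓞 ℚ), W.HasMultiplicativeReductionAt v →
      ¬ p ∣ W.ordMinimalDiscriminant v)
    (hadd : ∀ v : HeightOneSpectrum (𝓞 ℚ), W.HasAdditiveReductionAt v → p ≠ 3 ∨
      (W.kodairaSymbolAt v ≠ KodairaSymbol.IV ∧ W.kodairaSymbolAt v ≠ KodairaSymbol.IVstar))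
    {n₁ : ℕ} (hn₁ : Squarefree n₁)
    (hk₁ : ∀ q ∈ n₁.primeFactors, Zhang2014.IsKolyvaginPrime (W.conductorNorm ℤ) W K p q)
    (d₁ : KolyvaginHeegnerData Dt β ι n₁) (hne : d₁.kolyvaginClass hp.out 1 ≠ 0)
    (hrank : n₁.primeFactors.card + 1 ≤ W.mordellWeilRank) :
    Finite ↥(selmerGroup (W.quadraticTwist (NumberField.discr K : ℚ)) ((p ^ 1 : ℕ) : ℤ)) ∧
      Nat.card ↥(selmerGroup (W.quadraticTwist (NumberField.discr K : ℚ)) ((p ^ 1 : ℕ) : ℤ)) ≤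
        p ^ n₁.primeFactors.card ∧
      p ^ (W.quadraticTwist (NumberField.discr K : ℚ)).mordellWeilRank *
          Nat.card ↥(AddSubgroup.torsionBy (W.quadraticTwist (NumberField.discr K : ℚ)).toAffine.Point
            ((p ^ 1 : ℕ) : ℤ)) *
          Nat.card ↥((W.quadraticTwist (NumberField.discr K : ℚ)).sha ⊓
            AddSubgroup.torsionBy (W.quadraticTwist (NumberField.discr K : ℚ)).galH1 ((p ^ 1 : ℕ) : ℤ)) ≤
        p ^ n₁.primeFactors.card := by
  obtain ⟨S, hSel, hSp, hSc, hSK, hSτ⟩ := exists_hypothesesDepth_of_datum_of_hfin h372 hcm hK hD3 hD4 hH p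
    hp2 htower c hc hcc
    (fun _n hn hk d v hv ↦ kolyvaginClass_mem_selmerLocalKer_finite_one_of_kodairaNeron hK hD3 hD4 hH
      hp2 (by simpa only [pow_one] using htower 1) Dt β ι hmult hadd hn hk d v hv)
    hn₁ hk₁ d₁
  have hsupp : KolSupp S.Kol n₁ := by rw [hSK]; exact ⟨hn₁, hk₁⟩
  have hne' : S.c n₁ ≠ 0 := by rw [hSc]; exact hne
  exact natCard_selmerGroup_twist_le_of_hypothesesDepth W K hK.1 c hc p hp2 (pow_one p) S hSel hSp hSτ
    hsupp hne' hrank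

/-- **THE TWIST-SELMER DOOR OF A DATUM IN GENERAL, modulo (γ) + F1** (F1 =
`Gross1991_heegnerPoint_sub_ratTorsion_mem_E0`, [GZ86 III (3.1)]). CONDITIONAL on (γ) + F1; per-curve;
BSD is not proved by it. [cite: Kolyvagin1991MathAnn, Thm. 2.3] [cite: GrossZagier1986, III (3.1)] -/
theorem natCard_selmerGroup_twist_le_of_kolyvaginClass_ne_zero_of_datum_gross1991E0
    (h372 : GrossLMS1991.prop37_2_frobeniusCongruence)
    (hE0 : Gross1991_heegnerPoint_sub_ratTorsion_mem_E0)
    (hcm : ¬ W.HasCM) (hK : IsImaginaryQuadratic K) (hD3 : NumberField.discr K ≠ -3)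
    (hD4 : NumberField.discr K ≠ -4) (hH : SatisfiesHeegnerHypothesis (W.conductorNorm ℤ) K)
    (p : ℕ) [hp : Fact p.Prime] (hp2 : p ≠ 2)
    (htower : ∀ n : ℕ, W.HasSurjectiveModNGaloisRep (p ^ n : ℕ))
    (c : K ≃ₐ[ℚ] K) (hc : c ≠ 1) (hcc : c * c = 1)
    {n₁ : ℕ} (hn₁ : Squarefree n₁)
    (hk₁ : ∀ q ∈ n₁.primeFactors, Zhang2014.IsKolyvaginPrime (W.conductorNorm ℤ) W K p q)
    (d₁ : KolyvaginHeegnerData Dt β ι n₁) (hne : d₁.kolyvaginClass hp.out 1 ≠ 0)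
    (hrank : n₁.primeFactors.card + 1 ≤ W.mordellWeilRank) :
    Finite ↥(selmerGroup (W.quadraticTwist (NumberField.discr K : ℚ)) ((p ^ 1 : ℕ) : ℤ)) ∧
      Nat.card ↥(selmerGroup (W.quadraticTwist (NumberField.discr K : ℚ)) ((p ^ 1 : ℕ) : ℤ)) ≤
        p ^ n₁.primeFactors.card ∧
      p ^ (W.quadraticTwist (NumberField.discr K : ℚ)).mordellWeilRank *
          Nat.card ↥(AddSubgroup.torsionBy (W.quadraticTwist (NumberField.discr K : ℚ)).toAffine.Point
            ((p ^ 1 : ℕ) : ℤ)) *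
          Nat.card ↥((W.quadraticTwist (NumberField.discr K : ℚ)).sha ⊓
            AddSubgroup.torsionBy (W.quadraticTwist (NumberField.discr K : ℚ)).galH1 ((p ^ 1 : ℕ) : ℤ)) ≤
        p ^ n₁.primeFactors.card := by
  obtain ⟨S, hSel, hSp, hSc, hSK, hSτ⟩ := exists_hypothesesDepth_of_datum_of_hfin h372 hcm hK hD3 hD4 hH p
    hp2 htower c hc hcc
    (fun _n hn hk d v hv ↦ kolyvaginClass_mem_selmerLocalKer_finite_one_of_gross1991E0 hE0 hcm hK hD3
      hD4 hH hp2 (by simpa only [pow_one] using htower 1) Dt β ι hn hk d v hv)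
    hn₁ hk₁ d₁
  have hsupp : KolSupp S.Kol n₁ := by rw [hSK]; exact ⟨hn₁, hk₁⟩
  have hne' : S.c n₁ ≠ 0 := by rw [hSc]; exact hne
  exact natCard_selmerGroup_twist_le_of_hypothesesDepth W K hK.1 c hc p hp2 (pow_one p) S hSel hSp hSτ
    hsupp hne' hrank

end Datum

end Summit.BirchSwinnertonDyer.BirchSwinnertonDyer.Theorems.KolyvaginDepthDoor

end
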